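import Literature.MathematicalPhysics.QuantumFieldTheory.WilsonEnergyConvexity
import HarnessLib

/-!
# Venture YMGap, track ROBUST-BALL — the CHERNOFF BOUND FOR THE WILSON ACTION ON A TORUS: tail probabilities of the energy are
# partition-function ratios (door of «C-LD-E», the large-deviation upper bound for the energy density)

HONEST FRAMING. WHAT THIS IS: a venture file (cell `pub-ymgap`, track Y2 ROBUST-BALL / DS, seat ds-3, theorems only, 0 compute). Generic:
every compact gauge group `G`, continuous `ρ`, every dimension `d`, torus `(ℤ/L)^d`, every real coupling `b`, tilt `t` and level `a`:
* ★ `wilson_measureReal_tilt_le` — `μ_{Λ,b}{U : t·S(U) ≤ t·a} ≤ exp(t a + log Z_{Λ,b+t} − log Z_{Λ,b})` (`S` = Wilson action, `Z` = tree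
  `partitionFunction`, `log Z` = tree `torusLogPartition`): the exponential Markov inequality `𝟙{t(a − S) ≥ 0} ≤ e^{t(a−S)}` and the identity
  `⟨e^{−tS}⟩_{Λ,b} = Z_{Λ,b+t}/Z_{Λ,b}`. For `t > 0` this bounds the LOWER tail `{S ≤ a}` of the action (ordered configurations), for `t < 0` the
  UPPER tail `{S ≥ a}`; optimising over `t` against a free-energy law for `log Z` gives Cramér–Chernoff large-deviation upper bounds for the energy
  density — done for `SU(2)` on the strong-coupling window in the sequel `TorusEnergyLargeDeviations.lean` with the seat's «C-FSS» rate.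
WHAT THIS IS NOT: an upper bound only (no lower large-deviation bound, no rate-function identification); lattice; nothing continuum / Clay.
References: H. Cramér (1938) / H. Chernoff (1952) (statement type); everything here is proved. [folklore]
-/

noncomputable section

open MeasureTheory ProbabilityTheory Real Set
open Literature.MathematicalPhysics.QuantumLattice
open Literature.MathematicalPhysics.QuantumFieldTheory

namespace Summit.Ventures.YMGap.RobustBall

namespace TorusEnergyChernoff

variable {d L N : ℕ} {G : Type*} [Group G] [TopologicalSpace G] [IsTopologicalGroup G] [CompactSpace G]
  [MeasurableSpace G] [BorelSpace G] (ρ : G →* Matrix (Fin N) (Fin N) ℂ)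

/-- **The tilted Boltzmann factor has Wilson expectation a ratio of partition functions**:
`⟨exp(t(a − S))⟩_{Λ,b} = exp(t a) · Z_{Λ,b+t}/Z_{Λ,b}`, in logarithmic form. [folklore] -/
theorem wilsonExpectation_exp_tilt_eq [NeZero L] (hρ : Continuous ρ) (b t a : ℝ) :
    wilsonExpectation (d := d) (L := L) ρ b (fun U => Real.exp (t * (a - wilsonAction ρ U))) =
      Real.exp (t * a + torusLogPartition d ρ (b + t) L - torusLogPartition d ρ b L) := by
  have hZ := fun c => integral_exp_neg_mul_wilsonAction_pos (d := d) (L := L) ρ hρ c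
  rw [wilsonExpectation_eq_integral_div ρ hρ, torusLogPartition_eq_log_integral ρ hρ, torusLogPartition_eq_log_integral ρ hρ,
    Real.exp_sub, Real.exp_add, Real.exp_log (hZ _), Real.exp_log (hZ _), ← integral_const_mul]
  congr 1
  refine integral_congr_ae (ae_of_all _ fun U => ?_)
  dsimp only
  rw [← Real.exp_add, ← Real.exp_add]
  congr 1; ring

/-- ★ **THE CHERNOFF BOUND FOR THE WILSON ACTION ON A TORUS.** For every compact `G`, continuous `ρ`, torus `(ℤ/L)^d`, coupling `b`, tilt `t`
and level `a`: `μ_{Λ,b}{U : t·S(U) ≤ t·a} ≤ exp(t a + log Z_{Λ,b+t} − log Z_{Λ,b})` — for `t > 0` the lower tail `{S ≤ a}`, for `t < 0` the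
upper tail `{S ≥ a}`. [folklore] -/
theorem wilson_measureReal_tilt_le [NeZero L] (hρ : Continuous ρ) (b t a : ℝ) :
    (wilsonMeasure (d := d) (L := L) ρ b).real {U | t * wilsonAction ρ U ≤ t * a} ≤
      Real.exp (t * a + torusLogPartition d ρ (b + t) L - torusLogPartition d ρ b L) := by
  haveI := isProbabilityMeasure_wilsonMeasure (d := d) (L := L) ρ hρ b
  set μ := wilsonMeasure (d := d) (L := L) ρ b with hμ
  set A : Set (GaugeConfig d L G) := {U | t * wilsonAction ρ U ≤ t * a} with hA
  have hSm : Measurable (wilsonAction (d := d) (L := L) (G := G) ρ) := WilsonRP.measurable_wilsonAction ρ hρ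
  have hAm : MeasurableSet A := measurableSet_le (hSm.const_mul t) measurable_const
  have hint : Integrable (fun U : GaugeConfig d L G => Real.exp (t * (a - wilsonAction ρ U))) μ := by
    have h := (integrable_exp_mul_wilsonAction (d := d) (L := L) ρ hρ (-t) μ).const_mul (Real.exp (t * a))
    refine h.congr (ae_of_all _ fun U => ?_)
    show Real.exp (t * a) * Real.exp (-t * wilsonAction ρ U) = Real.exp (t * (a - wilsonAction ρ U))
    rw [← Real.exp_add]; congr 1; ring
  have hind : ∫ U, A.indicator (fun _ => (1 : ℝ)) U ∂μ = μ.real A := by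
    rw [integral_indicator_const _ hAm, smul_eq_mul, mul_one]
  rw [← hind, ← wilsonExpectation_exp_tilt_eq ρ hρ b t a]
  unfold wilsonExpectation
  refine integral_mono ((integrable_const _).indicator hAm) hint fun U => ?_
  by_cases hU : U ∈ A
  · rw [Set.indicator_of_mem hU]
    have hU' : t * wilsonAction ρ U ≤ t * a := hU
    exact Real.one_le_exp (by nlinarith)
  · rw [Set.indicator_of_notMem hU]
    exact (Real.exp_pos _).le

end TorusEnergyChernoff

end Summit.Ventures.YMGap.RobustBall

end
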